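import Literature.AlgebraicGeometry.Morphisms.ProjectiveOfFibreEmbedding
import Literature.AlgebraicGeometry.Morphisms.ClosedImmersionOfFibres
import HarnessLib

/-!
# A spanning family of global sections embeds `X ↪ ℙ^m_A` as soon as it does so fibrewise (EGA III 4.7.1, global over an affine base)

Topic `AlgebraicGeometry/Morphisms`; namespace `Literature.AlgebraicGeometry.Morphisms`. THEOREMS ONLY (no definition, no named
fact, no instance, no `sorry`).

`f : X → Spec A` proper and flat, `A` noetherian, `E` an `𝒪_X`-module with a rank-one frame system `F` (a line bundle with
chosen local generators), and `b₀,…,b_m ∈ Γ(X, E)` global sections which SPAN `Γ(X, E)` over `A` (through `f♯`; e.g. a frame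
`π_*E ≅ 𝒪^{m+1}`, the «linear rigidification» of Mumford–Fogarty–Kirwan Def. 7.5). Suppose that at every prime `𝔭` the fibre
`X_𝔭 = X ×_A κ(𝔭)` satisfies `Ext¹(𝒪_{X_𝔭}, E|_{X_𝔭}) = 0` and is EMBEDDED into a projective space by finitely many sections of
`E|_{X_𝔭}` generating it («`E` is fibrewise very ample with `H¹ = 0`»). Then

* `isClosedImmersion_toProj_of_fibres` — the `b_j` generate `E` and the morphism `X → ℙ^m_A` they define
  (★ `GeneratingSections.toProj` of ★ `CocycleSections.ofFrameSystem F h1 b`) is a CLOSED IMMERSION;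
* `isProjective_of_fibres` — in particular `f` is PROJECTIVE (★ `IsProjective`).

This is the global-over-`Spec A` form of EGA III 4.7.1 («fibrewise very ample ⇒ relatively very ample») combined with the
fibrewise criterion for closed immersions (★ `Morphisms/ClosedImmersionOfFibres`, EGA III 4.6.7 (ii)); it is the step
«`(A/T, λ, level, frame of π_*L^Δ(λ)³)` ↦ closed immersion `A ↪ ℙ^m_T`» of the construction of the moduli point (MFK Ch. 7 §2,
Prop. 7.3) over an affine `T`.

Road. §1 `isClosedImmersion_toProj_comap_of_fibre_embedding_of_span` (one prime, ANY fibre square `HX`): ★ G5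
`span_unitSectionLE_top_eq_top_at_prime` makes every fibre section a `κ(𝔭)`-combination of restricted global sections, hence
(as the `b_j` span) of the `η(b_j)`; by ★ `isClosedImmersion_toProj_of_linear` (brick 1) the `η(b_j)` embed the fibre, and ★
`ofCocycleSections_ofFrameSystem_pullback` (brick 2) rewrites this as a statement about the pulled-back datum
`(ofFrameSystem F h1 b).comap iX`. §2 assembles over all primes (canonical fibres = Mathlib `pullback`): generation pointwise,
and ★ `isClosedImmersion_of_forall_isPullback` with `P₀ = ℙ^m_{κ(𝔭)}` (★ `ProjBaseChangeRing.isPullback_projMap'`,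
★ `toProj_comp_SpecMap_algebraMap`, ★ `ofCocycleSections_comap`/`comap_toProj`).

Cell `hodgecm-mathlib`, F-DAG (h2) F-2a capital (B-p20 (g11)); consumer F-6 functor side. Count-neutral (HC_CM is proved only
modulo the 7 printed citations until rung 0 closes).

## References
* A. Grothendieck, J. Dieudonné, *EGA III₁* (Publ. Math. IHÉS 11, 1961), Thm. 4.7.1, Prop. 4.6.7 (ii). [EGAIII1]
* D. Mumford, J. Fogarty, F. Kirwan, *Geometric Invariant Theory*, 3rd ed. (1994), Ch. 7 §2, Def. 7.5 and Prop. 7.3. [MumfordFogartyKirwan1994]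
* D. Mumford, *Abelian Varieties* (1970), §5 Cor. 3 (p. 53). [MumfordAV1970]
* R. Hartshorne, *Algebraic Geometry* (1977), II Thm. 7.1, III Thm. 12.11. [Hartshorne1977]
-/

universe u

open CategoryTheory CategoryTheory.Limits CategoryTheory.Abelian AlgebraicGeometry TopologicalSpace Opposite
open Literature.AlgebraicGeometry.Modules
open Literature.AlgebraicGeometry.Motives Literature.AlgebraicGeometry.Motives.GeneratingSections
open Literature.AlgebraicGeometry.Motives.Segre

attribute [local instance] MvPolynomial.gradedAlgebra

-- `TopCat.Presheaf`/`Scheme.Modules` bookkeeping (as in ★ `Motives/GeneratingSectionsOfLineBundle`).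
set_option backward.isDefEq.respectTransparency false

noncomputable section

namespace Literature.AlgebraicGeometry.Morphisms

/-! ## §0 Bookkeeping -/

/-- Two-step restriction of `𝒪_X` equals the one-step restriction with the same ends. [folklore] -/
private theorem str_map_map_eq (Y : Scheme.{u}) {A B B' : Y.Opens} (p : op A ⟶ op B) (q : op B ⟶ op B')
    (r : op A ⟶ op B') (x : Γ(Y, A)) : Y.presheaf.map q (Y.presheaf.map p x) = Y.presheaf.map r x := by
  rw [← CommRingCat.comp_apply, ← Functor.map_comp]
  have : p ≫ q = r := congrArg Quiver.Hom.op (Subsingleton.elim (p ≫ q).unop r.unop)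
  rw [this]

/-- Restriction of `𝒪_Y(Y)` along `⊤ ≤ ⊤` is the identity. [folklore] -/
private theorem str_map_top (Y : Scheme.{u}) (y : Γ(Y, ⊤)) :
    Y.presheaf.map (homOfLE (le_top : (⊤ : Y.Opens) ≤ ⊤)).op y = y := by
  have h : (homOfLE (le_top : (⊤ : Y.Opens) ≤ ⊤)) = 𝟙 _ := Subsingleton.elim _ _
  rw [h, op_id]
  erw [CategoryTheory.Functor.map_id]
  rfl

/-- In a cartesian square `fst ≫ f = snd ≫ g`, a point `x` with `f x = g y` is `fst` of some point. [folklore] -/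
private theorem exists_fst_eq_of_isPullback {P X' Y Z : Scheme.{u}} {fst : P ⟶ X'} {snd : P ⟶ Y} {f : X' ⟶ Z}
    {g : Y ⟶ Z} (h : IsPullback fst snd f g) (x : X') (y : Y) (hxy : f x = g y) : ∃ p : P, x = fst p := by
  haveI : HasPullback f g := h.hasPullback
  obtain ⟨z, hz, -⟩ := Scheme.Pullback.exists_preimage_pullback x y hxy
  refine ⟨h.isoPullback.inv z, ?_⟩
  rw [← Scheme.Hom.comp_apply, IsPullback.isoPullback_inv_fst, hz]

/-- Membership in the span of a finite family, as an explicit combination (Mathlib's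
`Finsupp.mem_span_range_iff_exists_finsupp` summed over the finite index type). [folklore] -/
private theorem exists_fun_of_mem_span_range {R M : Type*} [Semiring R] [AddCommMonoid M] [Module R M] {α : Type*}
    [Fintype α] {v : α → M} {x : M} (hx : x ∈ Submodule.span R (Set.range v)) : ∃ c : α → R, ∑ i, c i • v i = x := by
  obtain ⟨c, hc⟩ := Finsupp.mem_span_range_iff_exists_finsupp.mp hx
  exact ⟨c, by rw [← hc, Finsupp.sum_fintype c (fun i a ↦ a • v i) (fun i ↦ zero_smul _ _)]⟩

/-! ## §1 At one prime: the restrictions of a spanning family embed the fibre -/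

section AtPrime

variable {A : Type} [CommRing A] [IsNoetherianRing A] {n m : ℕ} {X : Scheme.{0}} (f : X ⟶ Spec (.of A))
  [IsProper f] [Flat f] (𝔭 : PrimeSpectrum A)
  {X₀ : Scheme.{0}} {iX : X₀ ⟶ X} {f₀ : X₀ ⟶ Spec (.of 𝔭.asIdeal.ResidueField)}
  (HX : IsPullback iX f₀ f (Spec.map (CommRingCat.ofHom (algebraMap A 𝔭.asIdeal.ResidueField))))
  {E : X.Modules} (F : FrameSystem E) (h1 : ∀ x, F.rank x = 1)
  (hvan : Subsingleton (Ext.{1} (unitModule X₀) ((Scheme.Modules.pullback iX).obj E) 1))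
  (h1₀ : ∀ x, (F.pullback iX).rank x = 1)
  (s : Fin (n + 1) → Γ((Scheme.Modules.pullback iX).obj E, ⊤))
  (hcov : ⨆ i, ⨆ x, X₀.basicOpen ((CocycleSections.ofFrameSystem (F.pullback iX) h1₀ s).coeff i x) = ⊤)
  (H : IsClosedImmersion ((ofCocycleSections (F.pullback iX).U
    (CocycleSections.ofFrameSystem (F.pullback iX) h1₀ s) hcov).toProj f₀))
  (b : Fin (m + 1) → Γ(E, ⊤))
  (hb : Submodule.span Γ(Spec (.of A), ⊤)
    (Set.range fun j ↦ SecMod.mk (L := E) (ρ := f.appTop.hom) (U := ⊤) (b j)) = ⊤)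

include HX hvan H hb

/-- **The restrictions of a spanning family of global sections embed a fibre embedded by its own sections** (EGA III 4.7.1
at one prime, fibre-only hypotheses, GIVEN global sections): `f : X → Spec A` proper flat, `A` noetherian, `X₀ = X ×_A κ(𝔭)`
any cartesian square, `Ext¹(𝒪_{X₀}, E|_{X₀}) = 0`, fibre sections `s` generating `E|_{X₀}` and embedding `X₀`; if `b₀,…,b_m`
span `Γ(X, E)` over `A`, then the `b_j` generate `E` along `f⁻¹(𝔭)` and their restrictions embed `X₀ ↪ ℙ^m_{κ(𝔭)}` (pulled-back
datum ★ `(ofFrameSystem F h1 b).comap iX`). (★ G5: the `s_i` are `κ(𝔭)`-combinations of the `η(b_j)`; ★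
`isClosedImmersion_toProj_of_linear`.) [cite: EGAIII1, Thm. 4.7.1] [cite: MumfordAV1970, §5 Cor. 3 (p. 53)] -/
theorem isClosedImmersion_toProj_comap_of_fibre_embedding_of_span :
    (∀ x : X, f x = 𝔭 → ∃ j, x ∈ X.basicOpen (coeffAt F h1 b j x)) ∧
      ∃ hcov₀ : ⨆ j, ⨆ a, X₀.basicOpen (((CocycleSections.ofFrameSystem F h1 b).comap iX).coeff j a) = ⊤,
        IsClosedImmersion
          ((ofCocycleSections (fun a => iX ⁻¹ᵁ F.U a) ((CocycleSections.ofFrameSystem F h1 b).comap iX) hcov₀).toProj f₀) := by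
  classical
  -- Step 0: notation and instances
  haveI : IsProper f₀ := MorphismProperty.of_isPullback HX inferInstance
  let E₀ : X₀.Modules := (Scheme.Modules.pullback iX).obj E
  let F₀ : FrameSystem E₀ := F.pullback iX
  let η : Γ(E, ⊤) → Γ(E₀, ⊤) := fun u ↦ unitSectionLE iX E (V := ⊤) (U := ⊤) le_top u
  let jκ : Spec (.of 𝔭.asIdeal.ResidueField) ⟶ Spec (.of A) :=
    Spec.map (CommRingCat.ofHom (algebraMap A 𝔭.asIdeal.ResidueField))
  -- `η` is additive and `η(f♯(a) · u) = f₀♯(jκ♯ a) · η(u)`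
  have hηadd : ∀ u v, η (u + v) = η u + η v := fun u v ↦ unitSectionLE_add iX E le_top u v
  have hηsmul : ∀ (a : Γ(Spec (.of A), ⊤)) (u : Γ(E, ⊤)),
      η (toSections f.appTop.hom ⊤ a • u) = toSections f₀.appTop.hom ⊤ (jκ.appTop a) • η u := by
    intro a u
    change unitSectionLE iX E le_top (toSections f.appTop.hom ⊤ a • u) = _
    rw [unitSectionLE_smul]
    congr 1
    rw [toSections, toSections, RingHom.comp_apply, RingHom.comp_apply, str_map_top, str_map_top, appLE_top_top]
    change (f.appTop ≫ iX.appTop) a = (jκ.appTop ≫ f₀.appTop) a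
    rw [← Scheme.Hom.comp_appTop, ← Scheme.Hom.comp_appTop, HX.w]
  -- Step 1 (★ G5 + spanning): the `η(b_j)` span the fibre sections over `κ(𝔭)`
  have hspan := span_unitSectionLE_top_eq_top_at_prime f E F.isFiniteLocallyFree 𝔭.asIdeal HX hvan
  have hspan_b : Submodule.span Γ(Spec (.of 𝔭.asIdeal.ResidueField), ⊤)
      (Set.range fun j ↦ SecMod.mk (L := E₀) (ρ := f₀.appTop.hom) (U := ⊤) (η (b j))) = ⊤ := by
    rw [eq_top_iff, ← hspan, Submodule.span_le]
    rintro _ ⟨u, rfl⟩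
    obtain ⟨a, ha⟩ := exists_fun_of_mem_span_range
      (show u ∈ Submodule.span Γ(Spec (.of A), ⊤) (Set.range fun j ↦ SecMod.mk (L := E) (ρ := f.appTop.hom) (U := ⊤) (b j))
        by rw [hb]; exact Submodule.mem_top)
    rw [← ha]
    beta_reduce
    let ηh : Γ(E, ⊤) →+ Γ(E₀, ⊤) := AddMonoidHom.mk' η hηadd
    have hval : SecMod.val (L := E) (ρ := f.appTop.hom)
        (∑ j, a j • SecMod.mk (L := E) (ρ := f.appTop.hom) (U := ⊤) (b j)) =
        ∑ j, toSections f.appTop.hom ⊤ (a j) • b j := by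
      induction (Finset.univ : Finset (Fin (m + 1))) using Finset.induction_on with
      | empty => rfl
      | insert j T hj ih => rw [Finset.sum_insert hj, Finset.sum_insert hj, SecMod.val_add, ih]; rfl
    have hη : η (∑ j, toSections f.appTop.hom ⊤ (a j) • b j) =
        ∑ j, toSections f₀.appTop.hom ⊤ (jκ.appTop (a j)) • η (b j) := by
      change ηh _ = _
      rw [map_sum]
      exact Finset.sum_congr rfl fun j _ ↦ hηsmul (a j) (b j)
    have hmk : SecMod.mk (L := E₀) (ρ := f₀.appTop.hom) (U := ⊤)
        (unitSectionLE iX E le_top (SecMod.val (L := E) (ρ := f.appTop.hom)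
          (∑ j, a j • SecMod.mk (L := E) (ρ := f.appTop.hom) (U := ⊤) (b j)))) =
        ∑ j, jκ.appTop (a j) • SecMod.mk (L := E₀) (ρ := f₀.appTop.hom) (U := ⊤) (η (b j)) := by
      rw [hval]
      change SecMod.mk (η _) = _
      rw [hη]
      induction (Finset.univ : Finset (Fin (m + 1))) using Finset.induction_on with
      | empty => rfl
      | insert j T hj ih =>
        rw [Finset.sum_insert hj, Finset.sum_insert hj, ← ih]
        rfl
    rw [hmk]
    exact Submodule.sum_mem _ fun j _ ↦ Submodule.smul_mem _ _ (Submodule.subset_span ⟨j, rfl⟩)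
  -- Step 2: each `s i` is a `κ(𝔭)`-combination of the `η(b_j)`
  have hc : ∀ i, ∃ c : Fin (m + 1) → Γ(Spec (.of 𝔭.asIdeal.ResidueField), ⊤),
      ∑ j, c j • SecMod.mk (L := E₀) (ρ := f₀.appTop.hom) (U := ⊤) (η (b j)) =
        SecMod.mk (L := E₀) (ρ := f₀.appTop.hom) (U := ⊤) (s i) := fun i ↦
    exists_fun_of_mem_span_range (by rw [hspan_b]; exact Submodule.mem_top)
  choose c hc using hc
  have hrel : ∀ i, s i = ∑ j, toSections f₀.appTop.hom ⊤ (c i j) • η (b j) := fun i ↦ by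
    have h := congrArg (SecMod.val (L := E₀) (ρ := f₀.appTop.hom)) (hc i)
    rw [SecMod.val_mk] at h
    rw [← h]
    induction (Finset.univ : Finset (Fin (m + 1))) using Finset.induction_on with
    | empty => rfl
    | insert j T hj ih => rw [Finset.sum_insert hj, Finset.sum_insert hj, SecMod.val_add, ih]; rfl
  -- Step 3: the joint datum `(s, η ∘ b)` in the pulled-back frames and its linear relation over `κ(𝔭)`
  let u : Fin (n + 1) ⊕ Fin (m + 1) → Γ(E₀, ⊤) := Sum.elim s (fun j ↦ η (b j))
  let S : CocycleSections (Fin (n + 1) ⊕ Fin (m + 1)) F₀.U := CocycleSections.ofFrameSystem F₀ h1₀ u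
  let cc : Fin (n + 1) → Fin (m + 1) → 𝔭.asIdeal.ResidueField :=
    fun i j ↦ (Scheme.ΓSpecIso (.of 𝔭.asIdeal.ResidueField)).hom (c i j)
  have hpull : ∀ i j, pull f₀ (cc i j) = f₀.appTop (c i j) := fun i j ↦ by
    rw [pull_apply]
    change f₀.appTop (((Scheme.ΓSpecIso (.of 𝔭.asIdeal.ResidueField)).hom ≫
      (Scheme.ΓSpecIso (.of 𝔭.asIdeal.ResidueField)).inv) (c i j)) = _
    rw [Iso.hom_inv_id]
    rfl
  have hlin : ∀ i x, S.coeff (.inl i) x =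
      ∑ j, X₀.presheaf.map (homOfLE (le_top : F₀.U x ≤ ⊤)).op (pull f₀ (cc i j)) * S.coeff (.inr j) x := by
    intro i x
    change coeffAt F₀ h1₀ u (.inl i) x = ∑ j, _ * coeffAt F₀ h1₀ u (.inr j) x
    have hu : u (.inl i) = ∑ j ∈ Finset.univ, toSections f₀.appTop.hom ⊤ (c i j) • u (.inr j) := hrel i
    rw [coeffAt_sum_smul F₀ h1₀ Finset.univ (fun j ↦ toSections f₀.appTop.hom ⊤ (c i j)) (fun j ↦ u (.inr j)) u
      (.inl i) hu x]
    refine Finset.sum_congr rfl fun j _ ↦ ?_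
    congr 1
    rw [hpull, toSections, RingHom.comp_apply]
    exact str_map_map_eq X₀ _ _ _ _
  -- the two sub-families
  have hinl : S.restrict Sum.inl = CocycleSections.ofFrameSystem F₀ h1₀ s := CocycleSections.ext rfl
  have hinr : S.restrict Sum.inr = CocycleSections.ofFrameSystem F₀ h1₀ (fun j ↦ η (b j)) := CocycleSections.ext rfl
  have hcov_inl : ⨆ i, ⨆ x, X₀.basicOpen ((S.restrict Sum.inl).coeff i x) = ⊤ := by rw [hinl]; exact hcov
  have hcov_inr : ⨆ j, ⨆ x, X₀.basicOpen ((S.restrict Sum.inr).coeff j x) = ⊤ :=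
    iSup_basicOpen_inr_eq_top_of_linear f₀ S cc hlin hcov_inl
  have H' : IsClosedImmersion ((ofCocycleSections F₀.U (S.restrict Sum.inl) hcov_inl).toProj f₀) := by
    have e : ofCocycleSections F₀.U (S.restrict Sum.inl) hcov_inl =
        ofCocycleSections F₀.U (CocycleSections.ofFrameSystem F₀ h1₀ s) hcov := by
      congr 1
    rw [e]
    exact H
  -- Step 4 (brick 1): the restricted global sections `η(b_j)` embed the fibre
  have Ht : IsClosedImmersion ((ofCocycleSections F₀.U (S.restrict Sum.inr) hcov_inr).toProj f₀) :=
    isClosedImmersion_toProj_of_linear f₀ S cc hlin hcov_inl hcov_inr H'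
  have hcov_t : ⨆ j, ⨆ x, X₀.basicOpen ((CocycleSections.ofFrameSystem F₀ h1₀ (fun j ↦ η (b j))).coeff j x) = ⊤ := by
    rw [← hinr]; exact hcov_inr
  have Ht' : IsClosedImmersion ((ofCocycleSections F₀.U
      (CocycleSections.ofFrameSystem F₀ h1₀ (fun j ↦ η (b j))) hcov_t).toProj f₀) := by
    have e : ofCocycleSections F₀.U (CocycleSections.ofFrameSystem F₀ h1₀ (fun j ↦ η (b j))) hcov_t =
        ofCocycleSections F₀.U (S.restrict Sum.inr) hcov_inr := by
      congr 1
    rw [e]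
    exact Ht
  -- Step 5 (brick 2 §2): translate to the pulled-back datum of `b`
  have hcov₀ := iSup_basicOpen_comap_coeff_eq_top_of_pullback iX F h1 b h1₀ hcov_t
  refine ⟨fun x hx ↦ ?_, hcov₀, ?_⟩
  · have h𝔭 : f x = jκ (⊥ : PrimeSpectrum 𝔭.asIdeal.ResidueField) := by
      rw [hx]
      show 𝔭 = PrimeSpectrum.comap (algebraMap A 𝔭.asIdeal.ResidueField) ⊥
      ext1
      rw [PrimeSpectrum.comap_asIdeal, PrimeSpectrum.asIdeal_bot, ← RingHom.ker_eq_comap_bot,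
        Ideal.ker_algebraMap_residueField]
    obtain ⟨y, rfl⟩ := exists_fst_eq_of_isPullback HX x (⊥ : PrimeSpectrum 𝔭.asIdeal.ResidueField) h𝔭
    have hy : y ∈ (⊤ : X₀.Opens) := trivial
    rw [← hcov_t, Opens.mem_iSup] at hy
    obtain ⟨j, hj⟩ := hy
    rw [CocycleSections.ofFrameSystem_coeff, mem_iSup_basicOpen_coeffAt_iff] at hj
    exact ⟨j, mem_basicOpen_coeffAt_of_pullback iX F h1 b h1₀ j y hj⟩
  · rw [← ofCocycleSections_ofFrameSystem_pullback iX F h1 b h1₀ hcov_t hcov₀]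
    exact Ht'

end AtPrime

/-! ## §2 Over all primes: the global closed immersion `X ↪ ℙ^m_A` -/

section Global

variable {A : Type} [CommRing A] [IsNoetherianRing A] {m : ℕ} {X : Scheme.{0}} (f : X ⟶ Spec (.of A))
  [IsProper f] [Flat f] {E : X.Modules} (F : FrameSystem E) (h1 : ∀ x, F.rank x = 1)
  (b : Fin (m + 1) → Γ(E, ⊤))
  (hb : Submodule.span Γ(Spec (.of A), ⊤)
    (Set.range fun j ↦ SecMod.mk (L := E) (ρ := f.appTop.hom) (U := ⊤) (b j)) = ⊤)
  (hvan : ∀ 𝔭 : PrimeSpectrum A, Subsingleton (Ext.{1}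
    (unitModule (pullback f (Spec.map (CommRingCat.ofHom (algebraMap A 𝔭.asIdeal.ResidueField)))))
    ((Scheme.Modules.pullback
      (pullback.fst f (Spec.map (CommRingCat.ofHom (algebraMap A 𝔭.asIdeal.ResidueField))))).obj E) 1))
  (hemb : ∀ 𝔭 : PrimeSpectrum A, ∃ (n : ℕ)
    (s : Fin (n + 1) → Γ((Scheme.Modules.pullback
      (pullback.fst f (Spec.map (CommRingCat.ofHom (algebraMap A 𝔭.asIdeal.ResidueField))))).obj E, ⊤))
    (hcov : ⨆ i, ⨆ x, (pullback f (Spec.map (CommRingCat.ofHom (algebraMap A 𝔭.asIdeal.ResidueField)))).basicOpen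
      ((CocycleSections.ofFrameSystem
        (F.pullback (pullback.fst f (Spec.map (CommRingCat.ofHom (algebraMap A 𝔭.asIdeal.ResidueField)))))
        (fun _ ↦ h1 _) s).coeff i x) = ⊤),
    IsClosedImmersion ((ofCocycleSections
      (F.pullback (pullback.fst f (Spec.map (CommRingCat.ofHom (algebraMap A 𝔭.asIdeal.ResidueField))))).U
      (CocycleSections.ofFrameSystem
        (F.pullback (pullback.fst f (Spec.map (CommRingCat.ofHom (algebraMap A 𝔭.asIdeal.ResidueField)))))
        (fun _ ↦ h1 _) s) hcov).toProj
      (pullback.snd f (Spec.map (CommRingCat.ofHom (algebraMap A 𝔭.asIdeal.ResidueField))))))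

include hb hvan hemb

/-- **A spanning family generates everywhere if the fibres are generated** (all-primes form of §1, generation half): the
`b_j` have a unit coefficient at every point of `X`, i.e. the cover hypothesis of ★ `GeneratingSections.ofCocycleSections` holds
for `(E, b)`. [cite: EGAIII1, Thm. 4.7.1] [cite: MumfordAV1970, §5 Cor. 3 (p. 53)] -/
theorem iSup_basicOpen_coeffAt_eq_top_of_fibres_of_span :
    ⨆ j, ⨆ x : X, X.basicOpen (coeffAt F h1 b j x) = ⊤ := by
  refine (iSup_basicOpen_coeffAt_eq_top_iff F h1 b).mpr fun x ↦ ?_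
  obtain ⟨n, s, hcov, H⟩ := hemb (f x)
  exact (isClosedImmersion_toProj_comap_of_fibre_embedding_of_span f (f x) (IsPullback.of_hasPullback f _) F h1
    (hvan (f x)) (fun _ ↦ h1 _) s hcov H b hb).1 x rfl

/-- **EGA III 4.7.1, global over an affine base: a spanning family of global sections of a fibrewise very ample line bundle
with fibrewise `H¹ = 0` defines a CLOSED IMMERSION `X ↪ ℙ^m_A`.** `f : X → Spec A` proper flat, `A` noetherian, `F` a rank-one
frame system of `E`, `b₀,…,b_m ∈ Γ(X, E)` spanning `Γ(X, E)` over `A`; at every prime the fibre `X_𝔭 = X ×_A κ(𝔭)` has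
`Ext¹(𝒪, E|_{X_𝔭}) = 0` and is embedded by finitely many of its own sections generating `E|_{X_𝔭}`. Then the morphism
`X → ℙ^m_A` of the `b_j` (★ `ofCocycleSections … (ofFrameSystem F h1 b)`, Hartshorne II Thm. 7.1) is a closed immersion
(§1 at every prime + ★ `isClosedImmersion_of_forall_isPullback`, with `ℙ^m_{κ(𝔭)} = ℙ^m_A ×_A κ(𝔭)`).
[cite: EGAIII1, Thm. 4.7.1] [cite: EGAIII1, Prop. 4.6.7 (ii)] [cite: Hartshorne1977, II Thm. 7.1] -/
theorem isClosedImmersion_toProj_of_fibres :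
    IsClosedImmersion ((ofCocycleSections F.U (CocycleSections.ofFrameSystem F h1 b)
      (iSup_basicOpen_coeffAt_eq_top_of_fibres_of_span f F h1 b hb hvan hemb)).toProj f) := by
  haveI : IsProper (toSpec (Fin (m + 1)) A) := ProjBaseChangeRing.isProper_projToSpec (Fin (m + 1)) A
  have hcovb := iSup_basicOpen_coeffAt_eq_top_of_fibres_of_span f F h1 b hb hvan hemb
  refine isClosedImmersion_of_forall_isPullback f (toSpec (Fin (m + 1)) A)
    ((ofCocycleSections F.U (CocycleSections.ofFrameSystem F h1 b) hcovb).toProj f)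
    (GeneratingSections.toProj_toSpec _ _) fun 𝔭 ↦ ?_
  -- the fibre over `𝔭`, presented over `Spec κ(𝔭) = Spec (A → κ(𝔭))`, and `ℙ^m_{κ(𝔭)} = ℙ^m_A ×_A κ(𝔭)`
  let jκ : Spec (.of 𝔭.asIdeal.ResidueField) ⟶ Spec (.of A) :=
    Spec.map (CommRingCat.ofHom (algebraMap A 𝔭.asIdeal.ResidueField))
  have HX : IsPullback (pullback.fst f jκ) (pullback.snd f jκ) f jκ := IsPullback.of_hasPullback f jκ
  have HP : IsPullback
      (Proj.map (ProjBaseChangeRing.mapGraded A 𝔭.asIdeal.ResidueField (Fin (m + 1)))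
        (ProjBaseChangeRing.irrelevant_le_map A 𝔭.asIdeal.ResidueField (Fin (m + 1))))
      (toSpec (Fin (m + 1)) 𝔭.asIdeal.ResidueField) (toSpec (Fin (m + 1)) A) jκ :=
    ProjBaseChangeRing.isPullback_projMap' A 𝔭.asIdeal.ResidueField
  obtain ⟨n, s, hcov, H⟩ := hemb 𝔭
  obtain ⟨-, hcov₀, H₀⟩ := isClosedImmersion_toProj_comap_of_fibre_embedding_of_span f 𝔭 HX F h1 (hvan 𝔭)
    (fun _ ↦ h1 _) s hcov H b hb
  -- the fibre datum IS the restricted datum `D.comap iX`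
  have hD₀ : ofCocycleSections (fun a => (pullback.fst f jκ) ⁻¹ᵁ F.U a)
      ((CocycleSections.ofFrameSystem F h1 b).comap (pullback.fst f jκ)) hcov₀ =
      (ofCocycleSections F.U (CocycleSections.ofFrameSystem F h1 b) hcovb).comap (pullback.fst f jκ) :=
    ofCocycleSections_comap (pullback.fst f jκ) (CocycleSections.ofFrameSystem F h1 b) hcovb
  refine ⟨Spec (.of 𝔭.asIdeal.ResidueField), pullback f jκ, Proj (Segre.grading (Fin (m + 1)) 𝔭.asIdeal.ResidueField),
    jκ, Spec.map (Scheme.Spec.residueFieldIso (.of A) 𝔭).inv,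
    Scheme.Spec.map_residueFieldIso_inv_eq_fromSpecResidueField (.of A) 𝔭,
    pullback.fst f jκ, pullback.snd f jκ, HX, _, toSpec (Fin (m + 1)) 𝔭.asIdeal.ResidueField, HP,
    ((ofCocycleSections F.U (CocycleSections.ofFrameSystem F h1 b) hcovb).comap (pullback.fst f jκ)).toProj
      (pullback.snd f jκ), ?_, GeneratingSections.toProj_toSpec _ _, ?_⟩
  · rw [← GeneratingSections.toProj_comp_SpecMap_algebraMap, ← HX.w, GeneratingSections.comap_toProj]
  · rw [← hD₀]
    exact H₀

/-- **Hence `f : X → Spec A` is PROJECTIVE** (★ `IsProjective`, Hartshorne's definition: a closed immersion into `ℙ^m` over the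
base). [cite: EGAIII1, Thm. 4.7.1] [cite: Hartshorne1977, II §4 Definition p.103 (projective morphism)] -/
theorem isProjective_of_fibres : IsProjective f :=
  IsProjective.of_generatingSections f _ (isClosedImmersion_toProj_of_fibres f F h1 b hb hvan hemb)

end Global

/-! ## §3 Flexible fibre presentations (edition 2) -/

section Flexible

variable {A : Type} [CommRing A] [IsNoetherianRing A] {m : ℕ} {X : Scheme.{0}} (f : X ⟶ Spec (.of A))
  [IsProper f] [Flat f] {E : X.Modules} (F : FrameSystem E) (h1 : ∀ x, F.rank x = 1)
  (b : Fin (m + 1) → Γ(E, ⊤))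
  (hb : Submodule.span Γ(Spec (.of A), ⊤)
    (Set.range fun j ↦ SecMod.mk (L := E) (ρ := f.appTop.hom) (U := ⊤) (b j)) = ⊤)
  (hfib : ∀ 𝔭 : PrimeSpectrum A, ∃ (X₀ : Scheme.{0}) (iX : X₀ ⟶ X) (f₀ : X₀ ⟶ Spec (.of 𝔭.asIdeal.ResidueField))
    (_ : IsPullback iX f₀ f (Spec.map (CommRingCat.ofHom (algebraMap A 𝔭.asIdeal.ResidueField))))
    (_ : Subsingleton (Ext.{1} (unitModule X₀) ((Scheme.Modules.pullback iX).obj E) 1))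
    (h1₀ : ∀ x, (F.pullback iX).rank x = 1) (n : ℕ) (s : Fin (n + 1) → Γ((Scheme.Modules.pullback iX).obj E, ⊤))
    (hcov : ⨆ i, ⨆ x, X₀.basicOpen ((CocycleSections.ofFrameSystem (F.pullback iX) h1₀ s).coeff i x) = ⊤),
    IsClosedImmersion ((ofCocycleSections (F.pullback iX).U
      (CocycleSections.ofFrameSystem (F.pullback iX) h1₀ s) hcov).toProj f₀))

include hb hfib

/-- **Generation from the fibres, flexible presentations**: as `iSup_basicOpen_coeffAt_eq_top_of_fibres_of_span`, with each
fibre `X ×_A κ(𝔭)` presented by an ARBITRARY cartesian square (the form in which consumers hold their fibres, e.g. an abelian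
variety over `κ(𝔭)`). [cite: EGAIII1, Thm. 4.7.1] -/
theorem iSup_basicOpen_coeffAt_eq_top_of_fibres_of_span' :
    ⨆ j, ⨆ x : X, X.basicOpen (coeffAt F h1 b j x) = ⊤ := by
  refine (iSup_basicOpen_coeffAt_eq_top_iff F h1 b).mpr fun x ↦ ?_
  obtain ⟨X₀, iX, f₀, HX, hvan, h1₀, n, s, hcov, H⟩ := hfib (f x)
  exact (isClosedImmersion_toProj_comap_of_fibre_embedding_of_span f (f x) HX F h1 hvan h1₀ s hcov H b hb).1 x rfl

/-- **EGA III 4.7.1, global over an affine base, flexible fibre presentations**: as `isClosedImmersion_toProj_of_fibres`, with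
each fibre presented by an arbitrary cartesian square over `Spec κ(𝔭) → Spec A` carrying the `Ext¹`-vanishing and the embedding
sections: the spanning family `b` defines a CLOSED IMMERSION `X ↪ ℙ^m_A`. [cite: EGAIII1, Thm. 4.7.1] [cite: EGAIII1, Prop. 4.6.7 (ii)] -/
theorem isClosedImmersion_toProj_of_fibres' :
    IsClosedImmersion ((ofCocycleSections F.U (CocycleSections.ofFrameSystem F h1 b)
      (iSup_basicOpen_coeffAt_eq_top_of_fibres_of_span' f F h1 b hb hfib)).toProj f) := by
  haveI : IsProper (toSpec (Fin (m + 1)) A) := ProjBaseChangeRing.isProper_projToSpec (Fin (m + 1)) A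
  have hcovb := iSup_basicOpen_coeffAt_eq_top_of_fibres_of_span' f F h1 b hb hfib
  refine isClosedImmersion_of_forall_isPullback f (toSpec (Fin (m + 1)) A)
    ((ofCocycleSections F.U (CocycleSections.ofFrameSystem F h1 b) hcovb).toProj f)
    (GeneratingSections.toProj_toSpec _ _) fun 𝔭 ↦ ?_
  let jκ : Spec (.of 𝔭.asIdeal.ResidueField) ⟶ Spec (.of A) :=
    Spec.map (CommRingCat.ofHom (algebraMap A 𝔭.asIdeal.ResidueField))
  obtain ⟨X₀, iX, f₀, HX, hvan, h1₀, n, s, hcov, H⟩ := hfib 𝔭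
  have HP : IsPullback
      (Proj.map (ProjBaseChangeRing.mapGraded A 𝔭.asIdeal.ResidueField (Fin (m + 1)))
        (ProjBaseChangeRing.irrelevant_le_map A 𝔭.asIdeal.ResidueField (Fin (m + 1))))
      (toSpec (Fin (m + 1)) 𝔭.asIdeal.ResidueField) (toSpec (Fin (m + 1)) A) jκ :=
    ProjBaseChangeRing.isPullback_projMap' A 𝔭.asIdeal.ResidueField
  obtain ⟨-, hcov₀, H₀⟩ := isClosedImmersion_toProj_comap_of_fibre_embedding_of_span f 𝔭 HX F h1 hvan h1₀ s hcov H b hb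
  have hD₀ : ofCocycleSections (fun a => iX ⁻¹ᵁ F.U a) ((CocycleSections.ofFrameSystem F h1 b).comap iX) hcov₀ =
      (ofCocycleSections F.U (CocycleSections.ofFrameSystem F h1 b) hcovb).comap iX :=
    ofCocycleSections_comap iX (CocycleSections.ofFrameSystem F h1 b) hcovb
  refine ⟨Spec (.of 𝔭.asIdeal.ResidueField), X₀, Proj (Segre.grading (Fin (m + 1)) 𝔭.asIdeal.ResidueField),
    jκ, Spec.map (Scheme.Spec.residueFieldIso (.of A) 𝔭).inv,
    Scheme.Spec.map_residueFieldIso_inv_eq_fromSpecResidueField (.of A) 𝔭,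
    iX, f₀, HX, _, toSpec (Fin (m + 1)) 𝔭.asIdeal.ResidueField, HP,
    ((ofCocycleSections F.U (CocycleSections.ofFrameSystem F h1 b) hcovb).comap iX).toProj f₀, ?_,
    GeneratingSections.toProj_toSpec _ _, ?_⟩
  · rw [← GeneratingSections.toProj_comp_SpecMap_algebraMap, ← HX.w, GeneratingSections.comap_toProj]
  · rw [← hD₀]
    exact H₀

include h1 in
/-- Hence `f` is PROJECTIVE (flexible fibre presentations).
[cite: EGAIII1, Thm. 4.7.1] [cite: Hartshorne1977, II §4 Definition p.103 (projective morphism)] -/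
theorem isProjective_of_fibres' : IsProjective f :=
  IsProjective.of_generatingSections f _ (isClosedImmersion_toProj_of_fibres' f F h1 b hb hfib)

end Flexible

end Literature.AlgebraicGeometry.Morphisms
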